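import Mathlib

/-!
# OcticCMPointWitness — the CM point `B = A_Φ × A_{σΦ}` of `E = ℚ(ζ₅, √(4+√5))` on the kernel

Blind re-derivation cell `pub-hodge-repro`, seat night-2 (gen 0).  Target tree path
`lean/Summits/Ventures/HodgeRepro/OcticCMPointWitness.lean`.  Companion of `OcticCMPoint.lean`.

ROUTE-B §9.32 (merged in ROUTE.md v2.34, §3.4) exhibits, on a Python model, the explicit CM point of the first
open cell of S8: `E = ℚ(ζ₅, θ)`, `θ² = 4 + √5`, Galois closure `F = ℚ(ζ₅, θ, θ′)`, `θ′² = 4 − √5`, `[F : ℚ] = 16`,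
`Gal(F/ℚ) ≅ (C₂ × C₂) ⋊ C₄` acting on the eight embeddings `X = Hom(E, F) = {ι_{j,±} : j ∈ (ℤ/5)^×}`
(`ι_{j,±}: ζ₅ ↦ ζ₅^j, θ ↦ ±θ` for `j ∈ {1, 4}`, `θ ↦ ±θ′` for `j ∈ {2, 3}`), complex conjugation
`c = (ζ₅ ↦ ζ₅⁴, θ, θ′ fixed)`, the CM type `Φ = {(1,+), (1,−), (2,+), (3,−)}`, `σ = (ζ₅ ↦ ζ₅², θ ↦ θ′, θ′ ↦ θ)`,
`σΦ = {(1,−), (2,+), (2,−), (4,+)}`, and on `B = A_Φ × A_{σΦ}` the `4`-set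
`Δ = {(0,(1,+)), (0,(1,−)), (1,(3,+)), (1,(3,−))} ⊂ X ⊔ X`, Pohlmann-balanced under all 16 elements, neither half
balanced on its own factor, not a union of conjugate pairs, with no mixing Pohlmann pair («§9.32 (a): A KERNEL
VERSION is a typer-2 / p1 item if wanted: the G#8 action is a 16 × 8 table and the Pohlmann check of Δ under 16
elements is decide-sized»).  This file is that kernel version, in coordinates:

* `X = Fin 4 × Bool`, `(k, s) ↔ ι_{k+1, s}` (`s = true` the sign `+`); `jmul` is multiplication in `(ℤ/5)^×` on the
  index `k ↔ j = k + 1`;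
* the group elements are triples `(a, e₁, e₂) ∈ Fin 4 × Bool × Bool`: `ζ₅ ↦ ζ₅^{a+1}`, and `θ ↦ e₁θ, θ′ ↦ e₂θ′` when
  `a + 1 ∈ {1, 4}`, `θ ↦ e₁θ′, θ′ ↦ e₂θ` when `a + 1 ∈ {2, 3}`; they act on `X` by composition,
  `g ∘ ι_{j,s} = ι_{(a+1)j, s·e}` with `e = e₁` if `j ∈ {1, 4}` and `e = e₂` if `j ∈ {2, 3}` (`act`);
* `act_closed` / `act_faithful` / `act_one`: the sixteen maps form a group of order `16` acting faithfully
  (closed under composition, pairwise distinct, containing the identity) — the Galois group of `F/ℚ` on `Hom(E, F)`;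
* `Φ` is a CM type for `c` (`phi_isCMType`), `σΦ` is the displayed set (`sigma_phi`), and `σΦ` is not `Φ ∘ α` for
  any of the four automorphisms `α` of `E` (`sigma_phi_not_aut`: `ζ₅ ↦ ζ₅^{±1}, θ ↦ ±θ`, acting on `X` by
  precomposition) — the two factors are not isogenous;
* on `X ⊔ X = Bool × X` with the diagonal action: `Δ` is balanced under all sixteen elements
  (`delta_balanced`: `|gΔ ∩ Φ_B| = 2`), `Δ ∩ cΔ = ∅` (`delta_not_conj_stable`: not a union of conjugate pairs), no
  mixing pair `{(0, x), (1, y)}` is balanced (`no_mixing_pair`: `Hom(A_Φ, A_{σΦ}) = 0` on the model), and neither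
  half of `Δ` is balanced on its own factor (`delta_halves_unbalanced`).

What this says: on the combinatorial (Pohlmann) model of `H^•(B)` the class of `Δ` is a rational `(2,2)` Hodge
class of the CM `8`-fold `B` outside the divisor algebra — the exceptional `F`-line `W_{ℚ(ζ₅)}(B)` of ROUTE-B
§9.32 (b) — and the object the period closer C7 is asked about at this point is real.  What it does NOT say:
anything about algebraicity; the ranks `5` of `Φ`, `σΦ` (nondegeneracy) are not computed here.  Nothing here
says anything about the status of the Hodge conjecture for CM abelian varieties, which is NOT proved.
-/

set_option autoImplicit false

namespace Summit.Ventures.HodgeRepro.OcticCMPoint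

open Finset

/-- The eight embeddings `ι_{j,±}`, `j ∈ (ℤ/5)^×`: `(k, s) ↔ ι_{k+1, s}` (`s = true` is `+`). -/
abbrev X : Type := Fin 4 × Bool

/-- Multiplication in `(ℤ/5)^×` on the index `k ↔ j = k + 1`: `jmul a b ↔ (a+1)(b+1) mod 5`. -/
def jmul : Fin 4 → Fin 4 → Fin 4 :=
  ![![0, 1, 2, 3], ![1, 3, 0, 2], ![2, 0, 3, 1], ![3, 2, 1, 0]]

/-- `j ∈ {1, 4}` (the embeddings sending `θ` to `±θ`): `k ∈ {0, 3}`. -/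
def fixesSqrtFive (k : Fin 4) : Bool := k = 0 ∨ k = 3

/-- A Galois element `(a, e₁, e₂)`: `ζ₅ ↦ ζ₅^{a+1}`; `θ ↦ e₁θ, θ′ ↦ e₂θ′` if `a + 1 ∈ {1, 4}`, `θ ↦ e₁θ′, θ′ ↦ e₂θ` if
`a + 1 ∈ {2, 3}` (signs as `Bool`, `true = +`). -/
abbrev G : Type := Fin 4 × Bool × Bool

/-- The action by composition: `g ∘ ι_{j,s} = ι_{(a+1)j, s·e}` with `e = e₁` if `j ∈ {1, 4}`, `e = e₂` otherwise
(the product of two signs is their equality as Booleans). -/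
def act (g : G) (x : X) : X :=
  (jmul g.1 x.1, if fixesSqrtFive x.1 then (x.2 == g.2.1) else (x.2 == g.2.2))

/-- The identity `(1, +, +)` acts trivially. -/
theorem act_one : ∀ x : X, act (0, true, true) x = x := by decide

/-- The sixteen maps are closed under composition. -/
theorem act_closed : ∀ g g' : G, ∃ h : G, ∀ x : X, act g (act g' x) = act h x := by decide

/-- The sixteen maps are pairwise distinct (the action is faithful): a group of order `16`. -/
theorem act_faithful : ∀ g g' : G, (∀ x : X, act g x = act g' x) → g = g' := by decide

/-- Complex conjugation `c = (ζ₅ ↦ ζ₅⁴, θ, θ′ fixed)`: `a + 1 = 4`. -/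
def c : G := (3, true, true)

/-- `c` is a fixed-point-free involution on `X`. -/
theorem c_involution : (∀ x : X, act c (act c x) = x) ∧ ∀ x : X, act c x ≠ x := by decide

/-- The CM type `Φ = {(1,+), (1,−), (2,+), (3,−)}`. -/
def Φ : Finset X := {(0, true), (0, false), (1, true), (2, false)}

/-- `Φ` is a CM type: it contains exactly one of each conjugate pair `{x, c x}`. -/
theorem phi_isCMType : ∀ x : X, (x ∈ Φ ↔ act c x ∉ Φ) := by decide

/-- `σ = (ζ₅ ↦ ζ₅², θ ↦ θ′, θ′ ↦ θ)`: `a + 1 = 2`, both signs `+`. -/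
def σ : G := (1, true, true)

/-- `σΦ = {(1,−), (2,+), (2,−), (4,+)}`, as displayed in ROUTE-B §9.32. -/
theorem sigma_phi : Φ.image (act σ) = {(0, false), (1, true), (1, false), (3, true)} := by decide

/-- The automorphisms of `E` itself, `ζ₅ ↦ ζ₅^{a+1}` (`a + 1 ∈ {1, 4}`), `θ ↦ εθ`, acting on `X = Hom(E, F)` by
PRECOMPOSITION: `ι_{j,s} ∘ α = ι_{j(a+1), s·ε}`. -/
def ract (a : Fin 4) (ε : Bool) (x : X) : X := (jmul x.1 a, x.2 == ε)

/-- `σΦ ≠ Φ ∘ α` for every automorphism `α` of `E`: `A_Φ` and `A_{σΦ}` are not isogenous (ROUTE-B §9.32 (a):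
«not Φ∘α for any of the 4 automorphisms of E»). -/
theorem sigma_phi_not_aut : ∀ (a : Fin 4) (ε : Bool), fixesSqrtFive a = true →
    Φ.image (ract a ε) ≠ Φ.image (act σ) := by decide

/-- The points of `B = A_Φ × A_{σΦ}`: `X ⊔ X` as `Bool × X` (`false` = the first factor). -/
abbrev XB : Type := Bool × X

/-- The diagonal action on `X ⊔ X`. -/
def actB (g : G) (p : XB) : XB := (p.1, act g p.2)

/-- The CM type of `B`: `Φ` on the first factor, `σΦ` on the second. -/
def ΦB : Finset XB := (Φ.image fun x => ((false : Bool), x)) ∪ ((Φ.image (act σ)).image fun x => ((true : Bool), x))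

/-- The `4`-set `Δ = {(0,(1,+)), (0,(1,−)), (1,(3,+)), (1,(3,−))}` of ROUTE-B §9.32 (a). -/
def Δ : Finset XB := {(false, (0, true)), (false, (0, false)), (true, (2, true)), (true, (2, false))}

/-- **`Δ` is Pohlmann-balanced under all sixteen Galois elements**: `|gΔ ∩ Φ_B| = 2 = |Δ|/2` for every `g` — the
class of `Δ` is a rational Hodge class of type `(2,2)` on the combinatorial model of `H⁴(B)`. -/
theorem delta_balanced : ∀ g : G, ((Δ.image (actB g)) ∩ ΦB).card = 2 := by decide

/-- `Δ` meets its conjugate in nothing: it is not a union of conjugate pairs `{x, c x}` (so its class is not in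
the divisor algebra's conjugate-pair part — ROUTE-B §9.32 (a): «Δ is not a union of Pohlmann pairs»). -/
theorem delta_not_conj_stable : Δ ∩ Δ.image (actB c) = ∅ := by decide

/-- No mixing pair `{(0, x), (1, y)}` is balanced: `Hom(A_Φ, A_{σΦ}) = 0` on the model («mixing Pohlmann
pairs 0»). -/
theorem no_mixing_pair : ∀ x y : X, ∃ g : G,
    ((({((false : Bool), x), ((true : Bool), y)} : Finset XB).image (actB g)) ∩ ΦB).card ≠ 1 := by decide

/-- Neither half of `Δ` is balanced on its own factor: `{(1,+), (1,−)}` is not balanced for `Φ`, and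
`{(3,+), (3,−)}` is not balanced for `σΦ` («neither half is balanced on its own factor»). -/
theorem delta_halves_unbalanced :
    (∃ g : G, ((({(0, true), (0, false)} : Finset X).image (act g)) ∩ Φ).card ≠ 1) ∧
      (∃ g : G, ((({(2, true), (2, false)} : Finset X).image (act g)) ∩ Φ.image (act σ)).card ≠ 1) := by
  decide

end Summit.Ventures.HodgeRepro.OcticCMPoint
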